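import Literature.Topology.FourManifolds.FishtailIota
import Literature.Topology.FourManifolds.FishtailEndModelDepth
import Literature.Topology.FourManifolds.OpenEmbeddingExtend
import Literature.Topology.FourManifolds.GompfFramedTwistOfTubeModel
import Literature.Topology.FourManifolds.GompfFramedTwistOfShearModel
import Literature.Topology.FourManifolds.FramedTubularNbhd
import Literature.Topology.FourManifolds.SurgeryGluingTransport
import HarnessLib

/-!
# Gompf's fishtail diffeomorphism from the fishtail end map

Infrastructure for the explicit fishtail neighbourhood (R. Gompf, *More Cappell–Shaneson spheres
are standard*, Algebr. Geom. Topol. 10 (2010), proof of Thm 2.1 and Lemma 2.2; the named fact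
`Literature.Topology.FourManifolds.gompf2010_framedTwist`). Given the end map
`ι : MTorus Ψ → X^σ` (`FishtailIota.lean`) of the fishtail end model into the surgered mapping
torus `X^σ` of the tube shear, a local diffeomorphism on the model end `𝒪 = {im z₁ > 0}`, and
the geometric facts about its image collected in `IotaData.EndHyp` (injectivity, the image
misses the sliver, how the image meets the standard neighbourhood of the sliver, and two closure
facts about the moved set), we build **Gompf's fishtail diffeomorphism** of `X^σ ∖ Σ`:

* `IotaData.fishD` — the fishtail end model parameters (monodromy `Ψ`, the depth-dependent
  staircase `κ(z₁, s) = kapV (depth z₁) s` of `FishtailFace.lean`, a turn profile `u` of the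
  depth), and `IotaData.baseTurnO`, Gompf's base turn of Lemma 2.2 restricted to the model end;
* `IotaData.iotaY` — the end map as an open smooth embedding of the model end into
  `Y = X^σ ∖ Σ`;
* `IotaData.fishG` — the extension of `ι ∘ baseTurn ∘ ι⁻¹` by the identity
  (`extendDiffeomorph`, Hirsch Ch. 8 §1 Thm 1.3), and the four properties required by the
  hypothesis `hdata` of `gompf2010_framedTwist_of_tubeShearModel`
  (`IotaData.exists_twisting_data`).

Everything is proved; no named facts.

## References

* R. E. Gompf, *More Cappell–Shaneson spheres are standard*, Algebr. Geom. Topol. 10 (2010)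
  1665–1681, proof of Thm 2.1 (last paragraph) and Lemma 2.2 (proof). [GompfAGT2010]
* M. W. Hirsch, *Differential Topology*, GTM 33 (1976), Ch. 8 §1, Thm. 1.3. [Hirsch1976]
-/

noncomputable section

open scoped Real ContDiff Topology Manifold
open Set Function Filter Complex Metric

namespace Literature.Topology.FourManifolds

local notation "𝔼 " n:arg => EuclideanSpace ℝ (Fin n)
local notation "𝓣" =>
  (ModelWithCorners.prod (𝓡 1) (ModelWithCorners.prod (𝓡 1) (𝓡 1)))

namespace IotaData

variable (J : IotaData)

/-! ### The staircase and the turn profile of the model -/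

/-- The depth as a smooth function on the depth circle. [folklore] -/
theorem contMDiff_depth : ContMDiff (𝓡 1) 𝓘(ℝ, ℝ) ∞ J.depth := by
  have hre : ContMDiff (𝓡 1) 𝓘(ℝ, ℝ) ∞ fun z : Circle ↦ (z : ℂ).re :=
    (Complex.reCLM.contDiff (n := ∞)).comp_contMDiff contMDiff_coe_circle
  unfold depth
  exact (contMDiff_const.mul (contMDiff_const.sub hre)).div_const _

/-- **The staircase of the model** `κ(z₁, s) = kapV (depth z₁) s`. [folklore] -/
def kapM (z₁ : Circle) (s : ℝ) : ℝ := kapV (J.depth z₁) s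

/-- One period of the staircase is jointly smooth in `(z₁, s)` (for `E₁ ≤ 1/2`, `0 < E₁`): near
`|σ| < 1/4` it is the smooth transition of the argument at a depth in `[0, 1/2]`, elsewhere
locally constant. [folklore] -/
theorem contMDiffAt_kap0_depth (hE : 0 < J.E₁) (hE1 : J.E₁ ≤ 1 / 2) (c : ℝ) (p : Circle × ℝ) :
    ContMDiffAt ((𝓡 1).prod 𝓘(ℝ, ℝ)) 𝓘(ℝ, ℝ) ∞ (fun p : Circle × ℝ ↦ kap0 (J.depth p.1) (p.2 - c)) p := by
  have hd : ContMDiff ((𝓡 1).prod 𝓘(ℝ, ℝ)) 𝓘(ℝ, ℝ × ℝ) ∞ fun p : Circle × ℝ ↦ (J.depth p.1, p.2 - c) :=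
    ((J.contMDiff_depth).comp contMDiff_fst).prodMk_space (contMDiff_snd.sub contMDiff_const)
  rcases lt_or_ge (p.2 - c) sigLo with hlo | hlo
  · have hev : (fun p : Circle × ℝ ↦ kap0 (J.depth p.1) (p.2 - c)) =ᶠ[𝓝 p] fun _ ↦ 0 := by
      filter_upwards [(isOpen_lt (continuous_snd.sub continuous_const) continuous_const).mem_nhds hlo] with q hq
      exact kap0_of_le hq.le
    exact contMDiffAt_const.congr_of_eventuallyEq hev
  rcases lt_or_ge sigHi (p.2 - c) with hhi | hhi
  · have hev : (fun p : Circle × ℝ ↦ kap0 (J.depth p.1) (p.2 - c)) =ᶠ[𝓝 p] fun _ ↦ 1 := by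
      filter_upwards [(isOpen_lt continuous_const (continuous_snd.sub continuous_const)).mem_nhds hhi] with q hq
      exact kap0_of_ge hq.le
    exact contMDiffAt_const.congr_of_eventuallyEq hev
  · have hq : -(1 / 4) < p.2 - c := by linarith [sigLo_pos]
    have hq' : p.2 - c < 1 / 4 := hhi.trans_lt sigHi_lt_quarter
    have hev : (fun p : Circle × ℝ ↦ kap0 (J.depth p.1) (p.2 - c)) =ᶠ[𝓝 p]
        fun p ↦ Real.smoothTransition (kapArg (J.depth p.1) (p.2 - c)) := by
      have ho : IsOpen {q : Circle × ℝ | -(1 / 4) < q.2 - c ∧ q.2 - c < 1 / 4} :=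
        (isOpen_lt continuous_const (continuous_snd.sub continuous_const)).inter
          (isOpen_lt (continuous_snd.sub continuous_const) continuous_const)
      filter_upwards [ho.mem_nhds ⟨hq, hq'⟩] with q hq
      have hdq := J.depth_le hE q.1
      exact kap0_eq hdq.1 (hdq.2.trans hE1) hq.1 hq.2
    have hk : ContDiffAt ℝ ∞ (fun q : ℝ × ℝ ↦ Real.smoothTransition (kapArg q.1 q.2)) (J.depth p.1, p.2 - c) :=
      Real.smoothTransition.contDiff.contDiffAt.comp _ (contDiffAt_kapArg hq hq')
    exact (ContDiffAt.comp_contMDiffAt (f := fun p : Circle × ℝ ↦ (J.depth p.1, p.2 - c)) (x := p) hk (hd p)).congr_of_eventuallyEq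
      hev

/-- **The staircase of the model is jointly smooth.** [folklore] -/
theorem contMDiff_kapM (hE : 0 < J.E₁) (hE1 : J.E₁ ≤ 1 / 2) :
    ContMDiff ((𝓡 1).prod 𝓘(ℝ, ℝ)) 𝓘(ℝ, ℝ) ∞ fun p : Circle × ℝ ↦ J.kapM p.1 p.2 := by
  intro p
  have h0 := J.contMDiffAt_kap0_depth hE hE1 0 p
  have h1 := J.contMDiffAt_kap0_depth hE hE1 1 p
  simp only [sub_zero] at h0
  exact h0.add h1

/-- **The turn profile** `u(z₁) = 2π (1 - S((e - e_a)/(e_b - e_a)))`: full turn `2π` at depths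
`e ≤ e_a`, no turn at depths `e ≥ e_b`. [cite: GompfAGT2010, Lemma 2.2 (proof: (s,t,x) ↦ (s, s+t, x), the identity for s = 0)] -/
def uTurn (ea eb : ℝ) (z₁ : Circle) : ℝ := 2 * π * (1 - Real.smoothTransition ((J.depth z₁ - ea) / (eb - ea)))

/-- `ContMDiff (𝓡 1) 𝓘(ℝ, ℝ) ∞ (J.uTurn ea eb)`. [folklore] -/
theorem contMDiff_uTurn (ea eb : ℝ) : ContMDiff (𝓡 1) 𝓘(ℝ, ℝ) ∞ (J.uTurn ea eb) := by
  unfold uTurn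
  exact contMDiff_const.mul (contMDiff_const.sub ((Real.smoothTransition.contDiff.contMDiff).comp
    ((J.contMDiff_depth.sub contMDiff_const).div_const _)))

/-- `J.uTurn ea eb z = 2 * π`. [folklore] -/
theorem uTurn_of_le {ea eb : ℝ} (hab : ea < eb) {z : Circle} (h : J.depth z ≤ ea) : J.uTurn ea eb z = 2 * π := by
  rw [uTurn, Real.smoothTransition.zero_of_nonpos (div_nonpos_of_nonpos_of_nonneg (by linarith) (by linarith))]; ring

/-- `J.uTurn ea eb z = 0`. [folklore] -/
theorem uTurn_of_ge {ea eb : ℝ} (hab : ea < eb) {z : Circle} (h : eb ≤ J.depth z) : J.uTurn ea eb z = 0 := by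
  rw [uTurn, Real.smoothTransition.one_of_one_le ((one_le_div (by linarith)).2 (by linarith))]; ring

/-- **The fishtail end model of the data**: monodromy step arc `[θ₀ - w, θ₀ + w]`, staircase
`kapV (depth z₁)`, turn profile `uTurn e_a e_b`. [cite: GompfAGT2010, Lemma 2.2 (proof)] -/
def fishD (H : J.ModelHyp) (hE : 0 < J.E₁) (hE1 : J.E₁ ≤ 1 / 2) (ea eb : ℝ) : FishParamsD where
  a' := J.θ₀ - J.wS
  b' := J.θ₀ + J.wS
  ha' := H.ha
  hab' := H.hab
  hb' := H.hb
  κ := J.kapM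
  hκ := J.contMDiff_kapM hE hE1
  κ_add_one _ _ hs0 hs := kapV_add_one _ hs0 hs
  u := J.uTurn ea eb
  hu := J.contMDiff_uTurn ea eb

/-! ### Gompf's base turn on the model end -/

section Turn

variable (H : J.ModelHyp) (hE : 0 < J.E₁) (hE1 : J.E₁ ≤ 1 / 2) (ea eb : ℝ)

/-- The re-gluing diffeomorphisms of the end model respect the mapping torus relation of `Ψ`
(as `FishParamsD.mappingTorusRel_twist_iff`, for the monodromy written as `J.Ψ H`). [cite: GompfAGT2010, Lemma 2.2 (proof)] -/
theorem mappingTorusRel_twist_iff (p : ThreeTorus × ↥mappingTorusPieceOne) (q : ThreeTorus × ↥mappingTorusPieceTwo) :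
    mappingTorusRel (J.Ψ H) ((J.fishD H hE hE1 ea eb).twistOne p) ((J.fishD H hE hE1 ea eb).twistTwo q) ↔
      mappingTorusRel (J.Ψ H) p q := by
  set D := J.fishD H hE hE1 ea eb with hD
  have hg1 := D.lift_add_two_pi
  have hΨ : ∀ x, J.Ψ H x = fishMonodromy D.ha' D.hab' D.hb' x := fun x ↦ rfl
  obtain ⟨x, s⟩ := p
  obtain ⟨y, t⟩ := q
  simp only [mappingTorusRel, FishParamsD.twistOne_apply, FishParamsD.twistTwo_apply]
  refine or_congr ⟨fun ⟨h1, h2⟩ ↦ ⟨h1, ?_⟩, fun ⟨h1, h2⟩ ↦ ⟨h1, ?_⟩⟩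
    ⟨fun ⟨h1, h2⟩ ↦ ⟨h1, ?_⟩, fun ⟨h1, h2⟩ ↦ ⟨h1, ?_⟩⟩
  · have hd : y.1 = x.1 := by simpa using congrArg Prod.fst h2
    rw [h1, hd] at h2
    exact fishTurn_injective hg1 _ _ h2
  · rw [h1, h2]
  · have hs0 : 0 ≤ (s : ℝ) := s.2.1.le
    have hs : (s : ℝ) ≤ 1 / 2 := by have := t.2.2; rw [h1] at this; linarith
    have hd : y.1 = x.1 := by simpa using congrArg Prod.fst h2
    rw [h1, hd, D.κ_add_one x.1 s hs0 hs, hΨ, ← J.Ψ_fst H x, hΨ, ← fishTurn_fishMonodromy D.ha' D.hab' D.hb'] at h2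
    exact fishTurn_injective hg1 _ _ h2
  · have hs0 : 0 ≤ (s : ℝ) := s.2.1.le
    have hs : (s : ℝ) ≤ 1 / 2 := by have := t.2.2; rw [h1] at this; linarith
    rw [h1, h2, hΨ, show (fishMonodromy D.ha' D.hab' D.hb' x).1 = x.1 from rfl, D.κ_add_one x.1 s hs0 hs]
    exact fishTurn_fishMonodromy D.ha' D.hab' D.hb' _ _ x

/-- `MTorus Ψ` is an open gluing of the two cylinders along its own relation with the twisted
witnesses. [cite: GompfAGT2010, Lemma 2.2 (proof)] -/
theorem isOpenGluingWith_twist :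
    IsOpenGluingWith (ModelWithCorners.prod 𝓣 𝓘(ℝ, ℝ)) (ModelWithCorners.prod 𝓣 𝓘(ℝ, ℝ)) (𝓡 4)
      (mappingTorusRel ⇑(J.Ψ H))
      ((mtGlueData (J.Ψ H)).inl ∘ (J.fishD H hE hE1 ea eb).twistOne)
      ((mtGlueData (J.Ψ H)).inr ∘ (J.fishD H hE hE1 ea eb).twistTwo) := by
  obtain ⟨hA, hAo, hB, hBo, hU, hR⟩ := isOpenGluingWith_mappingTorusGlued (J.Ψ H) linTorusModel
  have hsA : Function.Surjective (J.fishD H hE hE1 ea eb).twistOne := (J.fishD H hE hE1 ea eb).twistOne.surjective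
  have hsB : Function.Surjective (J.fishD H hE hE1 ea eb).twistTwo := (J.fishD H hE hE1 ea eb).twistTwo.surjective
  refine ⟨hA.comp_diffeomorph _, ?_, hB.comp_diffeomorph _, ?_, ?_, fun p q ↦ ?_⟩
  · rwa [hsA.range_comp]
  · rwa [hsB.range_comp]
  · rwa [hsA.range_comp, hsB.range_comp]
  · rw [Function.comp_apply, Function.comp_apply, hR]
    exact J.mappingTorusRel_twist_iff H hE hE1 ea eb p q

/-- Gompf's diffeomorphism of the model mapping torus exists. [cite: GompfAGT2010, Lemma 2.2 (proof: the diffeomorphism extends over Φ)] -/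
theorem exists_baseTurnΨ :
    ∃ R : MTorus (J.Ψ H) ≃ₘ⟮𝓡 4, 𝓡 4⟯ MTorus (J.Ψ H),
      (∀ p, R ((mtGlueData (J.Ψ H)).inl ((J.fishD H hE hE1 ea eb).twistOne p)) = (mtGlueData (J.Ψ H)).inl p) ∧
      (∀ q, R ((mtGlueData (J.Ψ H)).inr ((J.fishD H hE hE1 ea eb).twistTwo q)) = (mtGlueData (J.Ψ H)).inr q) :=
  (isOpenGluingWith_twist J H hE hE1 ea eb).exists_diffeomorph_apply_eq
    (isOpenGluingWith_mappingTorusGlued (J.Ψ H) linTorusModel)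

/-- **Gompf's base turn** `[x, s] ↦ [F_{κ(x₁,s), u(x₁)} x, s]` of the model mapping torus. [cite: GompfAGT2010, Lemma 2.2 (proof: (s,t,x) ↦ (s, s+t, x))] -/
def baseTurnΨ : MTorus (J.Ψ H) ≃ₘ⟮𝓡 4, 𝓡 4⟯ MTorus (J.Ψ H) := (J.exists_baseTurnΨ H hE hE1 ea eb).choose.symm

/-- The base turn on the first cylinder. [folklore] -/
theorem baseTurnΨ_inl (p : ThreeTorus × ↥mappingTorusPieceOne) :
    J.baseTurnΨ H hE hE1 ea eb ((mtGlueData (J.Ψ H)).inl p) = (mtGlueData (J.Ψ H)).inl ((J.fishD H hE hE1 ea eb).twistOne p) := by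
  have h := (J.exists_baseTurnΨ H hE hE1 ea eb).choose_spec.1 p
  rw [baseTurnΨ, ← h, Diffeomorph.symm_apply_apply]

/-- The base turn on the second cylinder. [folklore] -/
theorem baseTurnΨ_inr (q : ThreeTorus × ↥mappingTorusPieceTwo) :
    J.baseTurnΨ H hE hE1 ea eb ((mtGlueData (J.Ψ H)).inr q) = (mtGlueData (J.Ψ H)).inr ((J.fishD H hE hE1 ea eb).twistTwo q) := by
  have h := (J.exists_baseTurnΨ H hE hE1 ea eb).choose_spec.2 q
  rw [baseTurnΨ, ← h, Diffeomorph.symm_apply_apply]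

/-- **The base turn preserves the depth circle.** [folklore] -/
theorem z1Of_baseTurnΨ (p : MTorus (J.Ψ H)) : J.z1Of H (J.baseTurnΨ H hE hE1 ea eb p) = J.z1Of H p := by
  rcases (mtGlueData (J.Ψ H)).exists_inl_or_inr p with ⟨a, rfl⟩ | ⟨b, rfl⟩
  · rw [baseTurnΨ_inl, z1Of_inl, z1Of_inl, FishParamsD.twistOne_apply, fishTurn_fst]
  · rw [baseTurnΨ_inr, z1Of_inr, z1Of_inr, FishParamsD.twistTwo_apply, fishTurn_fst]

/-- The base turn preserves the model end. [folklore] -/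
theorem baseTurnΨ_mem_endO {p : MTorus (J.Ψ H)} (hp : p ∈ J.endO H) : J.baseTurnΨ H hE hE1 ea eb p ∈ J.endO H := by
  rw [mem_endO, z1Of_baseTurnΨ]; exact hp

/-- `(J.baseTurnΨ H hE hE1 ea eb).symm p ∈ J.endO H`. [folklore] -/
theorem baseTurnΨ_symm_mem_endO {p : MTorus (J.Ψ H)} (hp : p ∈ J.endO H) :
    (J.baseTurnΨ H hE hE1 ea eb).symm p ∈ J.endO H := by
  rw [mem_endO, ← J.z1Of_baseTurnΨ H hE hE1 ea eb ((J.baseTurnΨ H hE hE1 ea eb).symm p), Diffeomorph.apply_symm_apply]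
  exact hp

/-- **Gompf's base turn on the model end** (the open submanifold `{im z₁ > 0}`). [cite: GompfAGT2010, Lemma 2.2 (proof: the diffeomorphism (s,t,x) ↦ (s,s+t,x) of the collar I × ∂Φ)] -/
def baseTurnO : ↥(J.endO H) ≃ₘ⟮𝓘(ℝ, 𝔼 4), 𝓘(ℝ, 𝔼 4)⟯ ↥(J.endO H) where
  toFun p := ⟨J.baseTurnΨ H hE hE1 ea eb p, J.baseTurnΨ_mem_endO H hE hE1 ea eb p.2⟩
  invFun p := ⟨(J.baseTurnΨ H hE hE1 ea eb).symm p, J.baseTurnΨ_symm_mem_endO H hE hE1 ea eb p.2⟩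
  left_inv p := Subtype.ext ((J.baseTurnΨ H hE hE1 ea eb).symm_apply_apply p)
  right_inv p := Subtype.ext ((J.baseTurnΨ H hE hE1 ea eb).apply_symm_apply p)
  contMDiff_toFun := by
    refine (ContMDiff.subtypeVal_comp_iff (J.endO H) _).1 ?_
    exact (J.baseTurnΨ H hE hE1 ea eb).contMDiff.comp contMDiff_subtype_val
  contMDiff_invFun := by
    refine (ContMDiff.subtypeVal_comp_iff (J.endO H) _).1 ?_
    exact (J.baseTurnΨ H hE hE1 ea eb).symm.contMDiff.comp contMDiff_subtype_val

/-- `(J.baseTurnO H hE hE1 ea eb p : MTorus (J.Ψ H)) = J.baseTurnΨ H hE hE1 ea eb p`. [folklore] -/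
@[simp] theorem coe_baseTurnO (p : ↥(J.endO H)) :
    (J.baseTurnO H hE hE1 ea eb p : MTorus (J.Ψ H)) = J.baseTurnΨ H hE hE1 ea eb p := rfl

end Turn

end IotaData

/-! ### The band neighbourhood of the sliver -/

section Band

/-- **The band neighbourhood of the far sliver**: `{re z₂ < -cos (1/8)} × (1 - η', 1 + η')` in the second
cylinder — the part of the standard neighbourhood `sliverNbhd` over the band `|arg z₂ - π| < 1/8`, which
still contains the far sliver (`τ = 1/10 < 1/8`) but misses the corner of the end region
(`|y - π| ≥ 3/20` there). [folklore] -/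
def bandNbhd (η' : ℝ) : TopologicalSpace.Opens (ThreeTorus × ↥mappingTorusPieceTwo) :=
  ⟨{b | ((b.1.2.1 : Circle) : ℂ).re < -Real.cos (1 / 8) ∧ b ∈ bicollarPiece η'},
    (isOpen_lt ((Complex.continuous_re.comp continuous_subtype_val).comp
      (continuous_fst.comp (continuous_snd.comp continuous_fst))) continuous_const).inter (bicollarPiece η').2⟩

/-- Membership in `bandNbhd`. [folklore] -/
@[simp] theorem mem_bandNbhd {η' : ℝ} {b : ThreeTorus × ↥mappingTorusPieceTwo} :
    b ∈ bandNbhd η' ↔ ((b.1.2.1 : Circle) : ℂ).re < -Real.cos (1 / 8) ∧ b ∈ bicollarPiece η' := Iff.rfl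

/-- The band neighbourhood lies in the standard neighbourhood. [folklore] -/
theorem bandNbhd_le_sliverNbhd (η' : ℝ) : bandNbhd η' ≤ sliverNbhd η' := fun b hb ↦
  ⟨lt_of_lt_of_le hb.1 (by have := Real.cos_pos_of_mem_Ioo (show (1:ℝ) / 8 ∈ Ioo (-(π / 2)) (π / 2) by
    constructor <;> linarith [Real.pi_gt_three]); linarith), hb.2⟩

/-- The band neighbourhood contains the far sliver of `τ = 1/10`. [folklore] -/
theorem fibreSliver_subset_bandNbhd {η' : ℝ} (hη' : 0 < η') : fibreSliver (farSupport tauFar) ⊆ bandNbhd η' := by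
  intro b hb
  obtain ⟨hb1, hb2⟩ := (mem_fibreSliver_iff).1 hb
  have hcos : Real.cos (π - tauFar) < -Real.cos (1 / 8) := by
    rw [Real.cos_pi_sub, tauFar, neg_lt_neg_iff]
    exact Real.cos_lt_cos_of_nonneg_of_le_pi_div_two (by norm_num) (by linarith [Real.pi_gt_three]) (by norm_num)
  refine ⟨lt_of_le_of_lt hb1 hcos, ?_⟩
  rw [mem_bicollarPiece, hb2]
  constructor <;> linarith

/-- The band neighbourhood misses the fibre through `1`. [folklore] -/
theorem bandNbhd_fst_ne_one (η' : ℝ) (b : ThreeTorus × ↥mappingTorusPieceTwo) (hb : b ∈ bandNbhd η') : b.1 ≠ 1 :=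
  sliverNbhd_fst_ne_one η' b (bandNbhd_le_sliverNbhd η' hb)

/-- The band neighbourhood is stable under the sliver twist of any map preserving `z₂`. [folklore] -/
theorem sliverTwist_mem_bandNbhd {η' : ℝ} {g : ThreeTorus → ThreeTorus} (hg2 : ∀ y, (g y).2.1 = y.2.1)
    (b : ThreeTorus × ↥mappingTorusPieceTwo) (hb : b ∈ bandNbhd η') : sliverTwist g b ∈ bandNbhd η' := by
  by_cases h1 : 1 < (b.2 : ℝ)
  · rw [sliverTwist_of_one_lt g h1]
    refine ⟨by rw [hg2]; exact hb.1, ?_⟩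
    have h := hb.2
    rw [mem_bicollarPiece] at h ⊢
    exact h
  · rw [sliverTwist_of_le_one g (not_lt.1 h1)]; exact hb

/-- The band neighbourhood of width `η' ≤ η` lies in the bicollar piece of width `η`. [folklore] -/
theorem bandNbhd_subset_bicollar {η' η : ℝ} (hle : η' ≤ η) (b : ThreeTorus × ↥mappingTorusPieceTwo)
    (hb : b ∈ bandNbhd η') : b ∈ bicollarPiece η :=
  sliverNbhd_subset_bicollar hle b (bandNbhd_le_sliverNbhd η' hb)

end Band

namespace IotaData

variable (J : IotaData)

/-! ### The geometric hypotheses on the end map -/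

/-- The product tube of the section circle (the surgery datum of `X^σ`). [folklore] -/
abbrev ν : CircleNbhd (𝓡 4) (prodPair tubeShearDiffeo J.ε J.hε (le_pi_of_le_half J.hε2) (tubeShearDiffeo_expT J.hε2)).secCircle :=
  fishNu J.hε J.hε2

/-- **`Y = X^σ ∖ Σ`**, the surgered complement of the far sliver (an open subset of `X^σ`). [folklore] -/
abbrev Yop : TopologicalSpace.Opens (fishNu J.hε J.hε2).Surgered :=
  (fishNu J.hε J.hε2).localOpens (prodSliverCompl tubeShearDiffeo (isClosed_farSupport tauFar))

section Hyp

variable (H : J.ModelHyp) (hE : 0 < J.E₁) (hE1 : J.E₁ ≤ 1 / 2) (ea eb : ℝ)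

/-- **The set of model points moved by the base turn** (inside the model end). [folklore] -/
def moved : Set (MTorus (J.Ψ H)) := {p | p ∈ J.endO H ∧ J.baseTurnΨ H hE hE1 ea eb p ≠ p}

variable (η' : ℝ) {r : ℝ} (hr : r ≤ π)

/-- **Geometric hypotheses on the fishtail end map** needed for Gompf's fishtail diffeomorphism:
injectivity on the model end; the image misses the sliver; on the standard neighbourhood of the
band neighbourhood of the sliver the base turn is carried to the sliver twist of Gompf's far Dehn twist, and points there
outside the image are fixed by that twist; the closure of the moved image meets `Y` inside the
image and lies in the surgered twisted cylinder neighbourhood of the tube of radius `r`. [cite: GompfAGT2010, Lemma 2.2 (proof) and Thm 2.1 (proof, last paragraph)] -/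
structure EndHyp : Prop where
  inj : Injective (J.iotaO H)
  memY : ∀ p ∈ J.endO H, J.iota H p ∈ J.Yop
  turn : ∀ p ∈ J.endO H, ∀ b ∈ bandNbhd η', b ∉ fibreSliver (farSupport tauFar) →
    J.iota H p = toSurg J.ν ((mtGlueData tubeShearDiffeo).inr b) →
    J.iota H (J.baseTurnΨ H hE hE1 ea eb p) =
      toSurg J.ν ((mtGlueData tubeShearDiffeo).inr (sliverTwist (farDehn tauFar_pos tauFar_lt) b))
  fix : ∀ b ∈ bandNbhd η', b ∉ fibreSliver (farSupport tauFar) →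
    toSurg J.ν ((mtGlueData tubeShearDiffeo).inr b) ∉ J.iota H '' (J.endO H : Set (MTorus (J.Ψ H))) →
    sliverTwist (farDehn tauFar_pos tauFar_lt) b = b
  hK : closure (J.iota H '' J.moved H hE hE1 ea eb) ∩ (J.Yop : Set (fishNu J.hε J.hε2).Surgered) ⊆
    J.iota H '' (J.endO H : Set (MTorus (J.Ψ H)))
  hKT : closure (J.iota H '' J.moved H hE hE1 ea eb) ⊆
    ((fishNu J.hε J.hε2).localOpens (twistNbhd tubeShearDiffeo 1 (axisTube hr)
      (Diffeotopy.refl 𝓣 ThreeTorus) (Diffeomorph.refl 𝓣 ThreeTorus ∞)) : Set (fishNu J.hε J.hε2).Surgered)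

end Hyp

/-! ### The end map as an open smooth embedding into `Y` -/

section Embedding

variable (H : J.ModelHyp) {δ : ℝ}

/-- **The end map of the model end into `Y`.** [folklore] -/
def iotaY (hY : ∀ p ∈ J.endO H, J.iota H p ∈ J.Yop) (p : ↥(J.endO H)) : ↥J.Yop := ⟨J.iota H p, hY p p.2⟩

variable {hY : ∀ p ∈ J.endO H, J.iota H p ∈ J.Yop}

/-- `(J.iotaY H hY p : (fishNu J.hε J.hε2).Surgered) = J.iota H p`. [folklore] -/
@[simp] theorem coe_iotaY (p : ↥(J.endO H)) : (J.iotaY H hY p : (fishNu J.hε J.hε2).Surgered) = J.iota H p := rfl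

/-- The end map into `Y` is a local diffeomorphism. [folklore] -/
theorem isLocalDiffeomorph_iotaY (HL : J.LocHyp δ) : IsLocalDiffeomorph 𝓘(ℝ, 𝔼 4) 𝓘(ℝ, 𝔼 4) ∞ (J.iotaY H hY) :=
  (J.isLocalDiffeomorph_iotaO H HL).codRestrict_opens J.Yop fun p ↦ hY p p.2

/-- **The end map into `Y` is an open smooth embedding** (an injective local diffeomorphism). [cite: GompfAGT2010, Lemma 2.2 (the fishtail neighbourhood embedded in X)] -/
theorem isSmoothEmbedding_iotaY (HL : J.LocHyp δ) (hinj : Injective (J.iotaO H)) :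
    Manifold.IsSmoothEmbedding 𝓘(ℝ, 𝔼 4) 𝓘(ℝ, 𝔼 4) ∞ (J.iotaY H hY) :=
  isSmoothEmbedding_of_isLocalDiffeomorph (J.isLocalDiffeomorph_iotaY H HL)
    (fun p q h ↦ hinj (show J.iota H p = J.iota H q from congrArg Subtype.val h)) (ContinuousLinearEquiv.refl ℝ (𝔼 4))

/-- `IsOpen (range (J.iotaY H hY))`. [folklore] -/
theorem isOpen_range_iotaY (HL : J.LocHyp δ) : IsOpen (range (J.iotaY H hY)) :=
  (J.isLocalDiffeomorph_iotaY H HL).isOpen_range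

end Embedding

/-! ### Gompf's fishtail diffeomorphism -/

section FishG

variable (H : J.ModelHyp) {δ : ℝ} (HL : J.LocHyp δ) (hE : 0 < J.E₁) (hE1 : J.E₁ ≤ 1 / 2) (ea eb η' : ℝ)
  {r : ℝ} (hr : r ≤ π) (E : J.EndHyp H hE hE1 ea eb η' hr)

/-- The support `Ksupp = closure (ι '' moved)` in `X^σ`. [folklore] -/
def Ksupp : Set (fishNu J.hε J.hε2).Surgered := closure (J.iota H '' J.moved H hE hE1 ea eb)

/-- The support read in `Y`. [folklore] -/
def KY : Set ↥J.Yop := Subtype.val ⁻¹' J.Ksupp H hE hE1 ea eb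

/-- `IsClosed (J.KY H hE hE1 ea eb)`. [folklore] -/
theorem isClosed_KY : IsClosed (J.KY H hE hE1 ea eb) := isClosed_closure.preimage continuous_subtype_val

include E in
/-- `J.KY H hE hE1 ea eb ⊆ range (J.iotaY H E.memY)`. [folklore] -/
theorem KY_subset_range : J.KY H hE hE1 ea eb ⊆ range (J.iotaY H E.memY) := by
  intro y hy
  obtain ⟨p, hp, hpy⟩ := E.hK ⟨hy, y.2⟩
  exact ⟨⟨p, hp⟩, Subtype.ext hpy⟩

include E in
/-- `J.baseTurnO H hE hE1 ea eb p = p`. [folklore] -/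
theorem baseTurnO_eq_of_not_mem (p : ↥(J.endO H)) (hp : J.iotaY H E.memY p ∉ J.KY H hE hE1 ea eb) :
    J.baseTurnO H hE hE1 ea eb p = p := by
  by_contra hne
  apply hp
  show J.iota H p ∈ closure (J.iota H '' J.moved H hE hE1 ea eb)
  refine subset_closure ⟨p, ⟨p.2, fun h ↦ hne (Subtype.ext h)⟩, rfl⟩

/-- **Gompf's fishtail diffeomorphism of `Y = X^σ ∖ Σ`**: `ι ∘ baseTurn ∘ ι⁻¹` on the image of
the model end, the identity elsewhere. [cite: GompfAGT2010, Lemma 2.2 (proof: the diffeomorphism extends over Φ) and Thm 2.1 (proof, last paragraph)] -/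
def fishG : ↥J.Yop ≃ₘ⟮𝓘(ℝ, 𝔼 4), 𝓘(ℝ, 𝔼 4)⟯ ↥J.Yop :=
  extendDiffeomorph (J.isSmoothEmbedding_iotaY H HL E.inj) (J.isOpen_range_iotaY H HL)
    (J.baseTurnO H hE hE1 ea eb) (J.isClosed_KY H hE hE1 ea eb) (J.KY_subset_range H hE hE1 ea eb η' hr E)
    (J.baseTurnO_eq_of_not_mem H hE hE1 ea eb η' hr E)

/-- On the image: `G (ι p) = ι (baseTurn p)`. [folklore] -/
theorem fishG_iotaY (p : ↥(J.endO H)) :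
    J.fishG H HL hE hE1 ea eb η' hr E (J.iotaY H E.memY p) = J.iotaY H E.memY (J.baseTurnO H hE hE1 ea eb p) :=
  extendDiffeomorph_apply _ _ _ _ _ _ p

/-- Off the image: `G = id`. [folklore] -/
theorem fishG_of_not_mem_range {y : ↥J.Yop} (hy : y ∉ range (J.iotaY H E.memY)) :
    J.fishG H HL hE hE1 ea eb η' hr E y = y :=
  extendDiffeomorph_of_not_mem _ _ _ _ _ _ hy

/-- **Off the support: `G = id`.** [folklore] -/
theorem fishG_of_not_mem_Ksupp {y : ↥J.Yop} (hy : (y : (fishNu J.hε J.hε2).Surgered) ∉ J.Ksupp H hE hE1 ea eb) :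
    J.fishG H HL hE hE1 ea eb η' hr E y = y :=
  extendDiffeomorph_of_not_mem_K _ _ _ _ _ _ hy

/-- Gompf's far Dehn twist preserves the `z₂`-coordinate. [folklore] -/
theorem farDehn_snd_fst {τ : ℝ} (hτ : 0 < τ) (hτ' : τ < π / 2) (y : ThreeTorus) : (farDehn hτ hτ' y).2.1 = y.2.1 := by
  rw [coe_farDehn, torusTwist_snd_fst]

/-- **The twisting property**: on the standard neighbourhood of the sliver, `G` maps the old point
`[b]` to the old point `[sliverTwist δ b]`. [cite: GompfAGT2010, Thm 2.1 (proof, last paragraph: cut along the front face and reglue by δ)] -/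
theorem fishG_twisting (x : ↥J.Yop) (b : ↥(bandNbhd η'))
    (hb : (b : ThreeTorus × ↥mappingTorusPieceTwo) ∉ fibreSliver (farSupport tauFar))
    (hx : (x : (fishNu J.hε J.hε2).Surgered) = (fishNu J.hε J.hε2).glueData.inl
      (opensToComplement (fishNu J.hε J.hε2) (mtGlueData tubeShearDiffeo).inr (bandNbhd η')
        (inr_not_mem_range_secCircle_self tubeShearDiffeo J.hε (le_pi_of_le_half J.hε2) (tubeShearDiffeo_expT J.hε2)
          (bandNbhd η') (bandNbhd_fst_ne_one η')) b)) :
    ∃ a' : ↥(fishNu J.hε J.hε2).complement,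
      (a' : MTorus tubeShearDiffeo) = (mtGlueData tubeShearDiffeo).inr (sliverTwist (farDehn tauFar_pos tauFar_lt) b) ∧
      (J.fishG H HL hE hE1 ea eb η' hr E x : (fishNu J.hε J.hε2).Surgered) = (fishNu J.hε J.hε2).glueData.inl a' := by
  have hVc := inr_not_mem_range_secCircle_self tubeShearDiffeo J.hε (le_pi_of_le_half J.hε2) (tubeShearDiffeo_expT J.hε2)
    (bandNbhd η') (bandNbhd_fst_ne_one η')
  -- the twisted point is an old point off the circle
  have hb' : sliverTwist (farDehn tauFar_pos tauFar_lt) (b : ThreeTorus × ↥mappingTorusPieceTwo) ∈ bandNbhd η' :=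
    sliverTwist_mem_bandNbhd (farDehn_snd_fst tauFar_pos tauFar_lt) _ b.2
  have hmem : (mtGlueData tubeShearDiffeo).inr (sliverTwist (farDehn tauFar_pos tauFar_lt) b) ∈ (fishNu J.hε J.hε2).complement :=
    ((fishNu J.hε J.hε2).mem_complement_iff _).2 (hVc _ hb')
  have hx' : (x : (fishNu J.hε J.hε2).Surgered) = toSurg J.ν ((mtGlueData tubeShearDiffeo).inr b) := by
    rw [hx, toSurg_eq_inl (((fishNu J.hε J.hε2).mem_complement_iff _).2 (hVc _ b.2))]
    rfl
  by_cases hxr : x ∈ range (J.iotaY H E.memY)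
  · obtain ⟨p, rfl⟩ := hxr
    refine ⟨⟨_, hmem⟩, rfl, ?_⟩
    rw [fishG_iotaY, coe_iotaY, coe_baseTurnO, ← toSurg_eq_inl hmem]
    exact E.turn p p.2 b b.2 hb hx'
  · refine ⟨⟨(mtGlueData tubeShearDiffeo).inr b, ((fishNu J.hε J.hε2).mem_complement_iff _).2 (hVc _ b.2)⟩, ?_, ?_⟩
    · have hfix := E.fix b b.2 hb (fun ⟨p, hp, hpx⟩ ↦ hxr ⟨⟨p, hp⟩, Subtype.ext (by rw [coe_iotaY, hpx, ← hx'])⟩)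
      simp only [hfix]
    · rw [J.fishG_of_not_mem_range H HL hE hE1 ea eb η' hr E hxr, hx]
      rfl

end FishG

/-! ### The twisting data at one tube radius, and F -/

section Data

variable (H : J.ModelHyp) {δ : ℝ} (HL : J.LocHyp δ) (hE : 0 < J.E₁) (hE1 : J.E₁ ≤ 1 / 2) (ea eb : ℝ) {η' : ℝ}
  (hη' : 0 < η') (hη'1 : η' ≤ 1) {r : ℝ} (hr : r ≤ π) (E : J.EndHyp H hE hE1 ea eb η' hr)

include HL hη' hη'1 E in
/-- **The fishtail twisting data of the tube-shear model at tube radius `r`** (the existential of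
the hypothesis `hdata` of `gompf2010_framedTwist_of_tubeShearModel`, at the product-tube radius
`ε` of the data): Gompf's far Dehn twist `δ`, the standard neighbourhood of the sliver, Gompf's
fishtail diffeomorphism `G` of `X^σ ∖ Σ` and its support. [cite: GompfAGT2010, Thm 2.1 (proof, last paragraph) and Lemma 2.2] -/
theorem exists_twistingData :
    ∃ (τ : ℝ) (hτ : 0 < τ) (hτ' : τ < π / 2) (η : ℝ) (_ : 0 < η)
      (Vδ : TopologicalSpace.Opens (ThreeTorus × ↥mappingTorusPieceTwo))
      (_ : fibreSliver (farSupport τ) ⊆ Vδ) (hV1 : ∀ b ∈ Vδ, b.1 ≠ 1)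
      (_ : ∀ b ∈ Vδ, sliverTwist (farDehn hτ hτ').symm b ∈ Vδ) (_ : ∀ b ∈ Vδ, b ∈ bicollarPiece η)
      (G : ↥((prodTube tubeShearDiffeo J.ε J.hε (le_pi_of_le_half J.hε2) (tubeShearDiffeo_expT J.hε2)).localOpens
          (prodSliverCompl tubeShearDiffeo (isClosed_farSupport τ))) ≃ₘ⟮𝓡 4, 𝓡 4⟯
        ↥((prodTube tubeShearDiffeo J.ε J.hε (le_pi_of_le_half J.hε2) (tubeShearDiffeo_expT J.hε2)).localOpens
          (prodSliverCompl tubeShearDiffeo (isClosed_farSupport τ))))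
      (Ksupp : Set (prodSurgered tubeShearDiffeo J.ε J.hε (le_pi_of_le_half J.hε2) (tubeShearDiffeo_expT J.hε2))),
      (∀ (x : ↥((prodTube tubeShearDiffeo J.ε J.hε (le_pi_of_le_half J.hε2) (tubeShearDiffeo_expT J.hε2)).localOpens
            (prodSliverCompl tubeShearDiffeo (isClosed_farSupport τ))))
          (b : ↥Vδ), (b : ThreeTorus × ↥mappingTorusPieceTwo) ∉ fibreSliver (farSupport τ) →
          (x : prodSurgered tubeShearDiffeo J.ε J.hε (le_pi_of_le_half J.hε2) (tubeShearDiffeo_expT J.hε2)) =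
            (prodTube tubeShearDiffeo J.ε J.hε (le_pi_of_le_half J.hε2) (tubeShearDiffeo_expT J.hε2)).glueData.inl
              (opensToComplement (prodTube tubeShearDiffeo J.ε J.hε (le_pi_of_le_half J.hε2) (tubeShearDiffeo_expT J.hε2))
                (mtGlueData tubeShearDiffeo).inr Vδ
                (inr_not_mem_range_secCircle_self tubeShearDiffeo J.hε (le_pi_of_le_half J.hε2) (tubeShearDiffeo_expT J.hε2)
                  Vδ hV1) b) →
          ∃ a' : ↥(prodTube tubeShearDiffeo J.ε J.hε (le_pi_of_le_half J.hε2) (tubeShearDiffeo_expT J.hε2)).complement,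
            (a' : MTorus tubeShearDiffeo) = (mtGlueData tubeShearDiffeo).inr (sliverTwist (farDehn hτ hτ') b) ∧
              (G x : prodSurgered tubeShearDiffeo J.ε J.hε (le_pi_of_le_half J.hε2) (tubeShearDiffeo_expT J.hε2)) =
                (prodTube tubeShearDiffeo J.ε J.hε (le_pi_of_le_half J.hε2) (tubeShearDiffeo_expT J.hε2)).glueData.inl a') ∧
      IsClosed Ksupp ∧
      Ksupp ⊆ (prodTube tubeShearDiffeo J.ε J.hε (le_pi_of_le_half J.hε2) (tubeShearDiffeo_expT J.hε2)).localOpens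
        (twistNbhd tubeShearDiffeo η (axisTube hr) (Diffeotopy.refl 𝓣 ThreeTorus) (Diffeomorph.refl 𝓣 ThreeTorus ∞)) ∧
      ∀ x : ↥((prodTube tubeShearDiffeo J.ε J.hε (le_pi_of_le_half J.hε2) (tubeShearDiffeo_expT J.hε2)).localOpens
          (prodSliverCompl tubeShearDiffeo (isClosed_farSupport τ))),
        (x : prodSurgered tubeShearDiffeo J.ε J.hε (le_pi_of_le_half J.hε2) (tubeShearDiffeo_expT J.hε2)) ∉ Ksupp → G x = x := by
  have hg2 : ∀ y, ((farDehn tauFar_pos tauFar_lt).symm y).2.1 = y.2.1 := fun y ↦ by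
    rw [coe_farDehn_symm, torusTwist_snd_fst]
  refine ⟨tauFar, tauFar_pos, tauFar_lt, 1, one_pos, bandNbhd η',
    fibreSliver_subset_bandNbhd hη', bandNbhd_fst_ne_one η',
    fun b hb ↦ sliverTwist_mem_bandNbhd hg2 b hb, fun b hb ↦ bandNbhd_subset_bicollar hη'1 b hb,
    J.fishG H HL hE hE1 ea eb η' hr E, J.Ksupp H hE hE1 ea eb, ?_, isClosed_closure, E.hKT, fun x hx ↦ ?_⟩
  · intro x b hb hx
    exact J.fishG_twisting H HL hE hE1 ea eb η' hr E x b hb hx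
  · exact J.fishG_of_not_mem_Ksupp H HL hE hE1 ea eb η' hr E hx

end Data

end IotaData

set_option maxHeartbeats 4000000 in
/-- **F from the fishtail data at every tube radius.** If for every tube radius `0 < r ≤ 1` there
are fishtail end data `J` of surgery radius `ε ≤ r/2` with the model, local-diffeomorphism and
end hypotheses, then `gompf2010_framedTwist` holds
(`gompf2010_framedTwist_of_tubeShearModel` with `ψ₀` the tube shear, which is `tubeShear`
everywhere). [cite: GompfAGT2010, Thm 2.1 and §4 ¶3] -/
theorem gompf2010_framedTwist_of_fishtailData
    (hJ : ∀ r : ℝ, 0 < r → r ≤ 1 → ∃ (J : IotaData) (H : J.ModelHyp) (δ : ℝ) (_ : J.LocHyp δ) (hE : 0 < J.E₁)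
      (hE1 : J.E₁ ≤ 1 / 2) (ea eb η' : ℝ) (_ : 0 < η') (_ : η' ≤ 1) (hrπ : r ≤ π)
      (_ : J.EndHyp H hE hE1 ea eb η' hrπ), J.ε ≤ r / 2) :
    gompf2010_framedTwist := by
  refine gompf2010_framedTwist_of_tubeShearModel tubeShearDiffeo one_pos (by linarith [Real.pi_gt_three])
    (fun z _ _ ↦ rfl) fun r hr hrr ↦ ?_
  obtain ⟨J, H, δ, HL, hE, hE1, ea, eb, η', hη', hη'1, hrπ, E, hεr⟩ := hJ r hr hrr
  obtain ⟨τ, hτ, hτ', η, hη, Vδ, hVS, hV1, hVg, hVη, G, Ksupp, h⟩ :=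
    J.exists_twistingData H HL hE hE1 ea eb hη' hη'1 hrπ E
  exact ⟨J.ε, J.hε, le_pi_of_le_half J.hε2, hεr, by linarith [J.hε2], tubeShearDiffeo_expT J.hε2, τ, hτ, hτ', η, hη,
    Vδ, hVS, hV1, hVg, hVη, G, Ksupp, h⟩

end Literature.Topology.FourManifolds
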